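import Summits.MatrixMultiplication.MatrixMultiplication.Theorems.AbelianSTPPCensusTAStatKMemberXSound

/-!
# Static t*-certificate: the multi-parameter k-member tree's bucket walk for universes beyond `6400` (data-free)

Cell mm-stpp (rung F-M1).  The bucket walks `TAStat2M.walk2` / `TAStatKM.walk3` / `TAStatKM.walk4` escape a bucket by `TAStat2M.tiOK V (TB[j])`, whose soundness
(`TAStat2M.tiOK_sound`) assumes `V < 6400` (the loop runs over `b < 80`).  A T_A range up to the order `6833` has maximal members of volume `≥ 6400`; this file
supplies `tiOK90` (loop over `b < 90`, sound for `V < 8100`) and `walk5` = `walk4` with the escape `tiOK90`, with `walk5_sound`.  Everything else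
(`coverKX`, `rootKX_sound`, …) is reused by name from `AbelianSTPPCensusTAStatKMemberX(Sound).lean` (vp-p2 gen 6).
WHAT THIS IS NOT: no statement about STPP families, orders or `ω` — Bool checks on shape data and their arithmetic meaning.
-/

set_option linter.dupNamespace false
set_option autoImplicit false

namespace Summit.MatrixMultiplication.MatrixMultiplication.Theorems.TAStatKM

open TECert (vol us)
open TAStat (Entry e0 cover)
open ShapeCert (D)

/-- integer test «every sorted shape `(a ≤ b ≤ c)` of volume `≤ V` has `a·b < t`», valid for `V < 8100`: for every `b < 90`, `min(b, ⌊V/b²⌋)·b < t`. -/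
def tiOK90 (V t : ℕ) : Bool := (List.range 90).all fun b => Nat.blt (min b (V / (b * b)) * b) t

/-- Soundness of `tiOK90`: `a ≤ b`, `1 ≤ a`, `a·b·b ≤ V < 8100` and `tiOK90 V t` give `a·b < t`. [original] -/
theorem tiOK90_sound {V t a b : ℕ} (h : tiOK90 V t = true) (ha : 1 ≤ a) (hab : a ≤ b) (hV : a * b * b ≤ V) (hV90 : V < 8100) :
    a * b < t := by
  have hb1 : 1 ≤ b := le_trans ha hab
  have hbb : b * b ≤ V := le_trans (by
    calc b * b = 1 * b * b := by ring
      _ ≤ a * b * b := Nat.mul_le_mul_right _ (Nat.mul_le_mul_right _ ha)) hV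
  have hb90 : b < 90 := by
    by_contra hc; push Not at hc
    have : 90 * 90 ≤ b * b := Nat.mul_le_mul hc hc
    omega
  simp only [tiOK90, List.all_eq_true, List.mem_range, Nat.blt_eq] at h
  have hb := h b hb90
  have hbpos : 0 < b * b := Nat.mul_pos (by omega) (by omega)
  have hadiv : a ≤ V / (b * b) := (Nat.le_div_iff_mul_le hbpos).2 (by
    calc a * (b * b) = a * b * b := by ring
      _ ≤ V := hV)
  have hamin : a ≤ min b (V / (b * b)) := le_min hab hadiv
  calc a * b ≤ min b (V / (b * b)) * b := Nat.mul_le_mul_right _ hamin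
    _ < t := hb

section Tree

variable (tb : ℕ → ℕ) (m2 : ℕ → List (ℕ × ℕ × ℕ)) (gain : ℕ → ℕ) (row : ℕ → Entry) (xrow : ℕ → List (ℕ × ℕ × ℕ)) (tp : ℕ → ℕ)

/-- Walk the buckets `j, j+1, …` of a table row (dropped to index `j`) for a maximal member whose own bucket is `j0`: escape once `tiOK90 V (TB[j])`,
else the one-member `cover` at `t = TP[j]` or the multi-parameter tree cover `coverKX` (as `walk4`, with the escape valid up to `V < 8100`). [original] -/
def walk5 (g p V d al tl kmax L H j0 : ℕ) : List Entry → ℕ → Bool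
  | [], _ => true
  | e :: es, j => tiOK90 V (tb j) ||
      ((cover g p V d (tp j) L H e || coverKX tb m2 gain row xrow g p V d al tl kmax j j0 L H) && walk5 g p V d al tl kmax L H j0 es (j + 1))

/-- Soundness of the walk: if no bucket `j + k'`, `k' ≤ k`, escapes, then at bucket `j + k` the one-member `cover` passes at `t = TP[j+k]` or the
tree cover passes. [bookkeeping] -/
theorem walk5_sound (g p V d al tl kmax L H j0 : ℕ) : ∀ (es : List Entry) (j : ℕ),
    walk5 tb m2 gain row xrow tp g p V d al tl kmax L H j0 es j = true →
    ∀ k, k < es.length → (∀ k', k' ≤ k → tiOK90 V (tb (j + k')) = false) →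
      cover g p V d (tp (j + k)) L H (es.getD k e0) = true ∨
        coverKX tb m2 gain row xrow g p V d al tl kmax (j + k) j0 L H = true
  | [], j, _, k, hk, _ => by simp at hk
  | e :: es, j, h, k, hk, hsmall => by
    have hunf : walk5 tb m2 gain row xrow tp g p V d al tl kmax L H j0 (e :: es) j = (tiOK90 V (tb j) ||
        ((cover g p V d (tp j) L H e || coverKX tb m2 gain row xrow g p V d al tl kmax j j0 L H) &&
          walk5 tb m2 gain row xrow tp g p V d al tl kmax L H j0 es (j + 1))) := rfl
    rw [hunf, Bool.or_eq_true, Bool.and_eq_true, Bool.or_eq_true] at h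
    rcases h with hstop | ⟨hc, hrest⟩
    · have h0 := hsmall 0 (Nat.zero_le _)
      simp only [Nat.add_zero] at h0
      rw [h0] at hstop
      exact absurd hstop Bool.false_ne_true
    · cases k with
      | zero => simpa using hc
      | succ k =>
        have hk' : k < es.length := by simpa using hk
        have := walk5_sound g p V d al tl kmax L H j0 es (j + 1) hrest k hk' (fun k' hk'' => by
          have := hsmall (k' + 1) (by omega)
          simpa [Nat.add_right_comm j 1 k', Nat.add_assoc] using this)
        simpa [Nat.add_right_comm j 1 k, Nat.add_assoc] using this

end Tree

end Summit.MatrixMultiplication.MatrixMultiplication.Theorems.TAStatKM
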